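import Summits.FinalStateConjecture.FinalStateConjecture.Theorems.StarvedNecksNecksCertifyStubConeSeparation
import Summits.FinalStateConjecture.FinalStateConjecture.Theorems.StarvedNecksGapDecaySufficesStubAnchoredLocationV2

/-!
# Route StarvedNecks — crux `GapDecaySuffices` (stmt-FinalStateConjecture-18060), line `Sketch`:
# band kinematics and the two isolated inputs of S4′ (`SeededLocationP`, skeleton v8)

The registered reduction header of skeleton v8 (lead c1),

  `Seeded.seededLocationP_of_uniformLocation : UniformLocation → LateSeed → SeededLocationP`

(file `…Theorems.StarvedNecksGapDecaySufficesStubSeededLocationMain`), consumes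

* the def-free real-variable / kinematic bricks of §1 (registered brick `lateFlat_band`):
  - `concaveOn_Ici_apply_mul_le` — `ρ'(μ s) ≤ μ ρ'(s)` for `ρ'` concave on `[0, ∞)` with
    `ρ'(0) ≥ 0`, `s ≥ 0`, `μ ≥ 1` (the chord from `0`): the wall-margin bookkeeping
    `2.9ρ'(z⁰) < 3ρ'(x⁰)` when a concave wall profile is read at two clocks whose ratio tends
    to `1`;
  - `lateFlat_band` — late bands `{ρᵢ(z⁰) < rᵢ z ≤ Cρ'(z⁰)}` of a sublinear profile are late-flat
    off every other excised tube with margin `1` (cone separation `…Cones.stub_coneSeparation`,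
    p106992);
  - `tendsto_max_div_atTop_nhds_zero`, `tendsto_abs_div_atTop_nhds_zero`,
    `tendsto_mul_max_add_div_atTop_nhds_zero`, `tendsto_div_of_abs_le` — sublinearity / domination
    bookkeeping for the kinematic majorant `Bk := max (max |Bk₁| |Bk₂|) (4·max(ρᵢ, 0) + 2R₀ + 1)`;
* the two precisely typed isolated inputs of §2 (statement bundles, namespace `…Location.Seeded`;
  verbatim the skeleton v8 defs of section S4″): X₁ `UniformLocation` (located-ness of ALL late
  common points of the flat band and the honest gap region) and X₂ `LateSeed` (ONE late common point
  at the anchoring window).  Their antecedents are VERBATIM those of `AnchoredP.SeededLocationP`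
  (p166857) through G5 — the bundles `AnchoredV2.HonestCore`, `HonestFar`, `DistinctVelocities`,
  `TubeAnchoredR` by name and the non-degeneracy `∀ᶠ s, 0 ≤ ρᵢ s` of the anchoring window; see each
  docstring for why it is true and what proving it needs.

Mathlib + `…Cones.stub_coneSeparation` + the landed bundles of `…StubAnchoredLocationV2`; no named
facts.  References: DHRT arXiv:2104.08222 §1; O'Neill 1983, Ch. 9.
-/

noncomputable section

open scoped Manifold ContDiff Topology ENNReal
open Filter Set Topology Literature.Geometry.Lorentzian

namespace Summit.FinalStateConjecture.FinalStateConjecture.Theorems.GapDecaySuffices.Location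

-- the route namespace repeats the summit name (`FinalStateConjecture.FinalStateConjecture`)
set_option linter.dupNamespace false

open Summit.FinalStateConjecture.FinalStateConjecture.Theorems.NecksCertifyTwoCap.Cones
  (stub_coneSeparation)

/-! ## §1 Band kinematics: concave majorants, late-flat bands, sublinear bookkeeping -/

/-- **Concave sublinear scaling**: a function concave on `[0, ∞)` with `ρ'(0) ≥ 0` satisfies
`ρ'(μ s) ≤ μ ρ'(s)` for `s ≥ 0`, `μ ≥ 1` (chord from `0`).  Used to compare a concave wall profile read
at two clocks whose ratio tends to `1`. [folklore] -/
theorem concaveOn_Ici_apply_mul_le {ρ' : ℝ → ℝ} (hconc : ConcaveOn ℝ (Set.Ici 0) ρ') (h0 : 0 ≤ ρ' 0)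
    {s μ : ℝ} (hs : 0 ≤ s) (hμ : 1 ≤ μ) : ρ' (μ * s) ≤ μ * ρ' s := by
  have hμ0 : 0 < μ := lt_of_lt_of_le one_pos hμ
  have ha : 0 ≤ 1 / μ := by positivity
  have hb : 0 ≤ 1 - 1 / μ := by
    rw [sub_nonneg, div_le_one hμ0]
    exact hμ
  have key := hconc.2 (x := μ * s) (y := 0) (Set.mem_Ici.2 (by positivity)) (Set.mem_Ici.2 le_rfl)
    ha hb (by ring)
  have harg : (1 / μ) • (μ * s) + (1 - 1 / μ) • (0 : ℝ) = s := by
    rw [smul_eq_mul, smul_eq_mul, mul_zero, add_zero]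
    field_simp
  rw [harg, smul_eq_mul, smul_eq_mul] at key
  have h1 : 1 / μ * ρ' (μ * s) ≤ ρ' s := by nlinarith
  rw [div_mul_eq_mul_div, one_mul, div_le_iff₀ hμ0] at h1
  linarith

/-- **Late bands are late-flat.**  For a final-state decomposition with orthochronous, pairwise
distinct asymptotic velocities, a hole `i`, a sublinear profile `ρ'` and any `C`: after some
coordinate time `T`, every coordinate point `z` with `T ≤ z⁰` and `ρᵢ(z⁰) < rᵢ z ≤ Cρ'(z⁰)` lies in
the flat domain, has `τ₀ < z⁰`, and clears every OTHER excised tube with margin `1` (cone separation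
`stub_coneSeparation`, p106992, and sublinearity of `ρ'`, `ρⱼ`). [folklore] -/
theorem lateFlat_band {𝓢 : Spacetime.{0} 4} {O : Set 𝓢.carrier} {k : ℕ}
    (d : FinalStateDecomposition 𝓢 O k)
    (horth : ∀ j, 0 < ((d.motion j).1 : E4 ≃L[ℝ] E4) (E4.basisVector 0) 0)
    (hdv : ∀ i j : Fin d.N, i ≠ j →
      ((d.motion i).1 : E4 ≃L[ℝ] E4) (E4.basisVector 0) ≠
        ((d.motion j).1 : E4 ≃L[ℝ] E4) (E4.basisVector 0))
    (i : Fin d.N) {ρ' : ℝ → ℝ} (hsub : Tendsto (fun s ↦ ρ' s / s) atTop (𝓝 0)) (C : ℝ) :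
    ∃ T : ℝ, ∀ z : E4, T ≤ z 0 → d.excision i (z 0) < (d.background i).radius z →
      (d.background i).radius z ≤ C * ρ' (z 0) →
      z ∈ d.flatDomain ∧ d.τ₀ < z 0 ∧
        ∀ j, j ≠ i → d.excision j (z 0) + 1 ≤ (d.background j).radius z := by
  obtain ⟨c, hc, τc, hcone⟩ := stub_coneSeparation 𝓢 O k d horth hdv
  have hE2 : ∀ᶠ s in atTop, ∀ j, d.excision j s + 1 ≤ c * s := by
    refine Filter.eventually_all.2 fun j ↦ ?_
    have h1 : ∀ᶠ s in atTop, d.excision j s / s < c / 2 :=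
      (d.tendsto_excision_div j).eventually (gt_mem_nhds (by positivity))
    filter_upwards [h1, eventually_gt_atTop (0 : ℝ), eventually_ge_atTop (2 / c)] with s hs hs0 hs2
    rw [div_lt_iff₀ hs0] at hs
    rw [div_le_iff₀' hc] at hs2
    linarith
  have hE3 : ∀ᶠ s in atTop, C * ρ' s < c * s := by
    have h1 : Tendsto (fun s ↦ C * (ρ' s / s)) atTop (𝓝 (C * 0)) := hsub.const_mul C
    rw [mul_zero] at h1
    filter_upwards [h1.eventually (gt_mem_nhds hc), eventually_gt_atTop (0 : ℝ)] with s hs hs0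
    rw [mul_div_assoc', div_lt_iff₀ hs0] at hs
    exact hs
  obtain ⟨T, hT⟩ := Filter.eventually_atTop.1
    (hE2.and (hE3.and ((eventually_ge_atTop τc).and (eventually_gt_atTop d.τ₀))))
  refine ⟨T, fun z hzT hlo hhi ↦ ?_⟩
  obtain ⟨hx2, hx3, hx4, hx5⟩ := hT (z 0) hzT
  have hri : (d.background i).radius z ≤ c * z 0 := hhi.trans hx3.le
  have hother : ∀ j, j ≠ i → d.excision j (z 0) + 1 ≤ (d.background j).radius z := by
    intro j hij
    have := hcone i j z (Ne.symm hij) hx4 hri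
    linarith [hx2 j]
  refine ⟨d.setOf_lt_excision_subset_flatDomain ⟨hx5, fun j ↦ ?_⟩, hx5, hother⟩
  show d.excision j (z 0) < (d.background j).radius z
  rcases eq_or_ne j i with rfl | hij
  · exact hlo
  · linarith [hother j hij]

/-- `max` of two sublinear functions is sublinear. [folklore] -/
theorem tendsto_max_div_atTop_nhds_zero {f g : ℝ → ℝ} (hf : Tendsto (fun s ↦ f s / s) atTop (𝓝 0))
    (hg : Tendsto (fun s ↦ g s / s) atTop (𝓝 0)) :
    Tendsto (fun s ↦ max (f s) (g s) / s) atTop (𝓝 0) := by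
  have h := hf.max hg
  rw [max_self] at h
  refine h.congr' ?_
  filter_upwards [eventually_gt_atTop 0] with s hs
  rw [max_div_div_right hs.le]

/-- The absolute value of a sublinear function is sublinear. [folklore] -/
theorem tendsto_abs_div_atTop_nhds_zero {f : ℝ → ℝ} (hf : Tendsto (fun s ↦ f s / s) atTop (𝓝 0)) :
    Tendsto (fun s ↦ |f s| / s) atTop (𝓝 0) := by
  have h : Tendsto (fun s ↦ |f s / s|) atTop (𝓝 0) := by simpa using hf.abs
  refine h.congr' ?_
  filter_upwards [eventually_gt_atTop 0] with s hs
  rw [abs_div, abs_of_pos hs]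

/-- `A · max f 0 + b` is sublinear when `f` is. [folklore] -/
theorem tendsto_mul_max_add_div_atTop_nhds_zero {f : ℝ → ℝ}
    (hf : Tendsto (fun s ↦ f s / s) atTop (𝓝 0)) (A b : ℝ) :
    Tendsto (fun s ↦ (A * max (f s) 0 + b) / s) atTop (𝓝 0) := by
  have h1 : Tendsto (fun s ↦ max (f s) 0 / s) atTop (𝓝 0) := by
    simpa using tendsto_max_div_atTop_nhds_zero hf
      (show Tendsto (fun s : ℝ ↦ (0 : ℝ) / s) atTop (𝓝 0) by simp)
  have h2 : Tendsto (fun s : ℝ ↦ A * (max (f s) 0 / s) + b / s) atTop (𝓝 (A * 0 + 0)) :=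
    (h1.const_mul A).add (tendsto_const_nhds.div_atTop tendsto_id)
  rw [mul_zero, add_zero] at h2
  refine h2.congr' ?_
  filter_upwards [eventually_gt_atTop 0] with s hs
  rw [add_div, mul_div_assoc]

/-- Domination transfers to minorants: `B/ρ → 0`, `|f| ≤ B`, `ρ > 0` give `f/ρ → 0`. [folklore] -/
theorem tendsto_div_of_abs_le {f B ρ : ℝ → ℝ} (h : Tendsto (fun s ↦ B s / ρ s) atTop (𝓝 0))
    (hρ : ∀ s, 0 < ρ s) (hle : ∀ s, |f s| ≤ B s) :
    Tendsto (fun s ↦ f s / ρ s) atTop (𝓝 0) := by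
  refine squeeze_zero_norm' ?_ h
  filter_upwards with s
  rw [Real.norm_eq_abs, abs_div, abs_of_pos (hρ s)]
  exact div_le_div_of_nonneg_right (hle s) (hρ s).le

/-! ## §2 The two isolated inputs of `seededLocationP_of_uniformLocation` (skeleton v8, S4″) -/

namespace Seeded

open AnchoredV2 (HonestCore HonestFar DistinctVelocities TubeAnchoredR)

/-- **X₁ `UniformLocation` — the analytic residue of S4′ (located-ness of ALL late common points of
the flat band and the honest gap region).**  Antecedents: those of `SeededLocation` VERBATIM through
G5, plus the non-degeneracy `∀ᶠ s, 0 ≤ ρᵢ s` of the anchoring window.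
CONCLUSION: a flat time `T`, a hole time `τ₂` and an antitone `κ → 0` such that for every late-flat
coordinate point `z` of the flat band — `T ≤ z⁰`, `τ₀ < z⁰`, `3ρᵢ(z⁰) + 2R₀ ≤ rᵢ z ≤ 2.9ρ'(z⁰)` (from the
inner radius of the anchoring window out to the collar), off every other excised tube with margin
`1` — and every point `x` of the HONEST part `{τ₂ ≤ tᵢ, rᵢ ≤ W(x⁰)}` (the G3/G4 region) of the gap
tube with `Ψg x = Φ z`, the hole clock and radius of `x` are within `κ(z⁰)ρ'(z⁰)` of those of `z`
(`x` is unique by G1).  WHY TRUE / WHAT IT NEEDS (on paper): a COARSE two-sided interval comparison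
for the transition `k = Ψg⁻¹ ∘ Φ` (exact isometry `η + h₁ → Bₘ + h₂`, `h₁, h₂ → 0`, Kerr tail `M/ρ'`)
WITHOUT an a-priori `‖Dk‖` bound — honest boost-flash plates exist
(`NegativeNotes-honest-vortex-flash-gauges` (E); a flash displaces by `≲ 1/δ ≪ κρ'`), the lead's open
E4-level point; then `QAZ.stub_quantAlexandrovZeeman` on balls of radius `~ρ'/C` chained along the
band; pinning of the fitted Poincaré maps to the declared axis by `TubeAnchoredR` over flat-time
spans `≫ Bk` (relative boost `→ 1`, transverse offset `o(ρ')`); the residual clock offset is absorbed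
into THIS statement's `∃ Bk`; lateness / location of `x` near `τ₂` from the coarse fit (the honest
slab `{tᵢ = const ≥ τ₂, rᵢ ≤ W}` is uniformly spacelike, so its flat times spread by `O(ρ')` only);
entry (`flat_entry_gapTube`, p143739) to have `k` defined on the balls.  L–XL for one worker given
the E4-level comparison lemma; everything else in it is the manifold bookkeeping of this line. -/
def UniformLocation : Prop :=
  ∀ (X : Type) [TopologicalSpace X] [ChartedSpace E3 X] [IsManifold (𝓡 3) ∞ X] [ConnectedSpace X]
    (D : InitialDataSet (𝓡 3) X), D ∈ admissibleVacuumData X →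
    ∀ 𝒟 : VacuumCauchyDevelopment D, 𝒟.IsMaximal →
    ∀ (O : Set 𝒟.carrier) (d : FinalStateDecomposition 𝒟.toSpacetime O 4) (R₀ : ℝ),
      O = exteriorOf 𝒟.toCauchyDevelopment d.charted →
      HonestCore 𝒟.toSpacetime O 4 d R₀ → HonestFar 𝒟.toSpacetime O 4 d R₀ →
      DistinctVelocities 𝒟.toSpacetime O 4 d → TubeAnchoredR d R₀ →
      ∀ i : Fin d.N, (∀ᶠ s in atTop, 0 ≤ d.excision i s) →
      ∃ Bk : ℝ → ℝ, Tendsto (fun s ↦ Bk s / s) atTop (𝓝 0) ∧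
      ∀ (ρ' : ℝ → ℝ), Monotone ρ' → Continuous ρ' → ConcaveOn ℝ (Set.Ici 0) ρ' →
        Tendsto (fun s ↦ ρ' s / s) atTop (𝓝 0) →
        Tendsto (fun s ↦ Bk s / ρ' s) atTop (𝓝 0) → (∀ s, 1 ≤ ρ' s) →
      ∀ (R₁ τ₁ : ℝ) (W : ℝ → ℝ) (Ψg : (d.background i).domain → 𝒟.carrier),
        let B := d.background i; let t := B.time; let r := B.radius;
        R₀ ≤ R₁ → d.τ₀ ≤ τ₁ → Continuous W → (∀ s, τ₁ ≤ s → 3 * ρ' s + 2 ≤ W s) →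
        (let U : Set B.domain := {x | τ₁ < t x.1 ∧ r x.1 < W (x.1 0) + 1};
          ContMDiffOn 𝓘(ℝ, E4) (𝓡 4) ∞ Ψg U ∧ Topology.IsOpenEmbedding (U.restrict Ψg) ∧
            Ψg '' U ⊆ d.charted) →
        (∀ x : B.domain, r x.1 ≤ R₁ + 1 → Ψg x = d.chart i x) →
        Tendsto (fun τ ↦ supCkENorm (Subtype.val '' {x : B.domain | t x.1 = τ ∧ r x.1 ≤ W (x.1 0)}) 2
          (𝒟.toSpacetime.deviationExtend B Ψg)) atTop (𝓝 0) →
        (∀ x : B.domain, τ₁ ≤ t x.1 → R₁ ≤ r x.1 → r x.1 ≤ W (x.1 0) →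
          𝒟.toSpacetime.timeOrientation.IsFutureDirected
            (mfderiv 𝓘(ℝ, E4) (𝓡 4) Ψg x (((d.motion i).1 : E4 ≃L[ℝ] E4) (E4.basisVector 0)))) →
        (∀ (τ' : ℝ) (ϱ : ℝ → ℝ), Continuous ϱ → τ₁ < τ' →
          (∀ x : B.domain, τ' ≤ t x.1 → r x.1 ≤ ϱ (t x.1) → r x.1 ≤ W (x.1 0)) →
          closure (Ψg '' {x | τ' ≤ t x.1 ∧ r x.1 ≤ ϱ (t x.1)}) ∩ O ⊆
            Ψg '' {x | τ' ≤ t x.1 ∧ r x.1 ≤ ϱ (t x.1)}) →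
        ∃ (T τ₂ : ℝ) (κ : ℝ → ℝ), Antitone κ ∧ Tendsto κ atTop (𝓝 0) ∧
          ∀ (z : E4) (hz : z ∈ d.flatDomain), T ≤ z 0 → d.τ₀ < z 0 →
            3 * d.excision i (z 0) + 2 * R₀ ≤ r z → r z ≤ 29 / 10 * ρ' (z 0) →
            (∀ j, j ≠ i → d.excision j (z 0) + 1 ≤ (d.background j).radius z) →
            ∀ x : B.domain, τ₂ ≤ t x.1 → r x.1 ≤ W (x.1 0) → Ψg x = d.flatChart ⟨z, hz⟩ →
              |t x.1 - t z| ≤ κ (z 0) * ρ' (z 0) ∧ |r x.1 - r z| ≤ κ (z 0) * ρ' (z 0)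

/-- **X₂ `LateSeed` — ONE late common point at the anchoring window (seed transport through the
input hole chart).**  Antecedents: those of `SeededLocation` VERBATIM through G5, plus
`∀ᶠ s, 0 ≤ ρᵢ s`.  CONCLUSION: for every flat time `T` and hole time `τ₂` there is a flat-domain point
`z` of the anchoring window `3ρᵢ(z⁰) + 2R₀ ≤ rᵢ z ≤ 4ρᵢ(z⁰) + 2R₀`, `T ≤ z⁰`, whose flat image is `Ψg x`
for a point `x` of the honest gap region `{τ₂ ≤ tᵢ, rᵢ ≤ W(x⁰)}`.  WHY TRUE / WHAT IT NEEDS: a late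
flat time `s ≥ T` with `ρᵢ(s) ≥ 0` beyond the threshold of `TubeAnchoredR`; the window point is
late-flat (`lateFlat_band`) and has an anchored `Ψᵢ`-preimage `x`, `R₀ ≤ rᵢ x ≤ 9ρᵢ(s) + 3R₀`.
(a) If `rᵢ x` stays BOUNDED along a sequence of such `s → ∞` (e.g. `liminf ρᵢ < ∞`): lateness
`tᵢ x → ∞` is COMPACTNESS — a limit point of `Ψᵢ xₙ = Φ yₙ`, `yₙ⁰ → ∞`, `xₙ` in the compact
`{τ₀ ≤ tᵢ ≤ τ₂, R₀ ≤ rᵢ ≤ L}`, would by `Hf`(2) have late flat preimages of EVERY lateness, contradicting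
injectivity of `Φ` on the late flat domain — and then `x⁰ → ∞` (clock bound), `W(x⁰) ≥ 3ρ'(x⁰) + 2 → ∞`
(`ρ' → ∞` is forced by `Bk ≥ 1`), so eventually `rᵢ x ≤ R₁ + 1 ≤ W(x⁰)` and `Ψg x = Ψᵢ x` (G2): M-sized.
(b) If `ρᵢ → ∞`: transport `Ψᵢ x` into `Ψg`'s honest region through the honest band
(`hole_entry_gapTube`, seeded by G2 inside `R₁ + 1`, no rim contact from the 1/10 honesty `Hf`(3) of
`Ψᵢ` and G3 of `Ψg` against the SAME background, wall `3ρ' + 2 ≫ 9ρᵢ + 3R₀` by this statement's `Bk`)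
AND a coarse CLOCK-RATE comparison `x⁰ ≳ y⁰/C` between the two charts (to read the wall at the right
time and to get lateness), which the typed `TubeAnchoredR` withholds ("no clock window"): L-sized.
SUGGESTION for the misstatement boundary `Hf`(4) (= `LabelMatching`'s output): add the physically free
coarse clock window `y⁰ ≤ C·(tᵢ x + 1)` to the conclusion of `TubeAnchoredR`; then (b) reduces to (a)'s
bookkeeping plus the band transport. -/
def LateSeed : Prop :=
  ∀ (X : Type) [TopologicalSpace X] [ChartedSpace E3 X] [IsManifold (𝓡 3) ∞ X] [ConnectedSpace X]
    (D : InitialDataSet (𝓡 3) X), D ∈ admissibleVacuumData X →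
    ∀ 𝒟 : VacuumCauchyDevelopment D, 𝒟.IsMaximal →
    ∀ (O : Set 𝒟.carrier) (d : FinalStateDecomposition 𝒟.toSpacetime O 4) (R₀ : ℝ),
      O = exteriorOf 𝒟.toCauchyDevelopment d.charted →
      HonestCore 𝒟.toSpacetime O 4 d R₀ → HonestFar 𝒟.toSpacetime O 4 d R₀ →
      DistinctVelocities 𝒟.toSpacetime O 4 d → TubeAnchoredR d R₀ →
      ∀ i : Fin d.N, (∀ᶠ s in atTop, 0 ≤ d.excision i s) →
      ∃ Bk : ℝ → ℝ, Tendsto (fun s ↦ Bk s / s) atTop (𝓝 0) ∧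
      ∀ (ρ' : ℝ → ℝ), Monotone ρ' → Continuous ρ' → ConcaveOn ℝ (Set.Ici 0) ρ' →
        Tendsto (fun s ↦ ρ' s / s) atTop (𝓝 0) →
        Tendsto (fun s ↦ Bk s / ρ' s) atTop (𝓝 0) → (∀ s, 1 ≤ ρ' s) →
      ∀ (R₁ τ₁ : ℝ) (W : ℝ → ℝ) (Ψg : (d.background i).domain → 𝒟.carrier),
        let B := d.background i; let t := B.time; let r := B.radius;
        R₀ ≤ R₁ → d.τ₀ ≤ τ₁ → Continuous W → (∀ s, τ₁ ≤ s → 3 * ρ' s + 2 ≤ W s) →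
        (let U : Set B.domain := {x | τ₁ < t x.1 ∧ r x.1 < W (x.1 0) + 1};
          ContMDiffOn 𝓘(ℝ, E4) (𝓡 4) ∞ Ψg U ∧ Topology.IsOpenEmbedding (U.restrict Ψg) ∧
            Ψg '' U ⊆ d.charted) →
        (∀ x : B.domain, r x.1 ≤ R₁ + 1 → Ψg x = d.chart i x) →
        Tendsto (fun τ ↦ supCkENorm (Subtype.val '' {x : B.domain | t x.1 = τ ∧ r x.1 ≤ W (x.1 0)}) 2
          (𝒟.toSpacetime.deviationExtend B Ψg)) atTop (𝓝 0) →
        (∀ x : B.domain, τ₁ ≤ t x.1 → R₁ ≤ r x.1 → r x.1 ≤ W (x.1 0) →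
          𝒟.toSpacetime.timeOrientation.IsFutureDirected
            (mfderiv 𝓘(ℝ, E4) (𝓡 4) Ψg x (((d.motion i).1 : E4 ≃L[ℝ] E4) (E4.basisVector 0)))) →
        (∀ (τ' : ℝ) (ϱ : ℝ → ℝ), Continuous ϱ → τ₁ < τ' →
          (∀ x : B.domain, τ' ≤ t x.1 → r x.1 ≤ ϱ (t x.1) → r x.1 ≤ W (x.1 0)) →
          closure (Ψg '' {x | τ' ≤ t x.1 ∧ r x.1 ≤ ϱ (t x.1)}) ∩ O ⊆
            Ψg '' {x | τ' ≤ t x.1 ∧ r x.1 ≤ ϱ (t x.1)}) →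
        ∀ T τ₂ : ℝ, ∃ (z : E4) (hz : z ∈ d.flatDomain), T ≤ z 0 ∧
          3 * d.excision i (z 0) + 2 * R₀ ≤ r z ∧ r z ≤ 4 * d.excision i (z 0) + 2 * R₀ ∧
          ∃ x : B.domain, τ₂ ≤ t x.1 ∧ r x.1 ≤ W (x.1 0) ∧ Ψg x = d.flatChart ⟨z, hz⟩

end Seeded

end Summit.FinalStateConjecture.FinalStateConjecture.Theorems.GapDecaySuffices.Location

end
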